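import Literature.NumberTheory.EllipticCurves.Tian2014.CMPointSystemCosetTransversal
import Literature.NumberTheory.EllipticCurves.Tian2014.CMPointSystemDescentPrimeSeven
import Literature.NumberTheory.EllipticCurves.Tian2014.CMPointSystemDescentOneThree
import HarnessLib

/-!
# Tian 2014 Thm. 4.4 at `k = 1` (`n = p₀p₁`, `p₀ ≡ 7`, `p₁ ≡ 1 (mod 8)`) on the `n ≡ 3 (mod 4)` CM-point system, I:
# the four cosets of `2𝒜` through `β = σ_{t₀}` and `[ϖ′_{p₁}]`, Tian's transversal `φ = ⋃_{[s]∈ψ}[s]φ₀`, and the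
# relation (4.9) at `k = 1` for both twists

Cell `bsd-monsky` (prover-A seat, g15; `run/shared/lean/pub/bsd-monsky/`). HONEST FRAMING (README §1): nothing is asserted
about BSD, nothing is booked, no `_holds`, no named fact; this file PROVES theorems on the data `D : CMPointData n` of
`CMPointSystemDisplays.lean` (Tian's Thm. 2.8 system) with its printed properties as hypotheses. NOTHING NEW ON PAPER: Tian
proves Thm. 4.4 in print by induction on `k`; this is the bookkeeping of its FIRST STEP `k = 1` (`n = p₀p₁`, `p₀ ≡ 7`,
`p₁ ≡ 1 (mod 8)`) — Monsky's Cor. 5.15 (3) «`p₁p₇` and `2p₁p₇` when `(p₁/p₇) = −1`» (Thm. 5.14 (10)/(11)) — transplanted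
onto Tian's points by TIAN'S route. The descent itself is in `CMPointSystemDescentOneSeven.lean`; this file is the
Galois/transversal bookkeeping.

## Source (verbatim, arXiv:1210.8231)

* p0025 L21–L29: "Let `φ₀` be a set of representatives of `2𝒜/([ϖ′])`. Let `ψ` be a set of representatives of `𝒜/2𝒜`. Then
  `φ = ⋃_{[s]∈ψ} [s]φ₀` is a set of representatives of `𝒜/([ϖ′])`. We use this `φ` to define all `y_d`'s. Let `β ∈
  Gal(H(i)/K(i))` be an element which moves `√2, √p₁, ⋯, √p_k`. Then `β` fixes or moves `√p₀` according to that `k` is odd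
  or even."
* Lemma 4.8 (p0025 L30–L51): "(2) Let `y₀ := Σ_{[t]∈φ₀} z_t`. Then `y₀ + (−1)^m y₀^β` is rational over the genus subfield
  `H₀ = K(√−p₀, √p₁, ⋯, √p_k)` of `K`. These points satisfy the following relation: (4.9) `Σ_{p₀|d|2n, ν₀(d) ≡ ν₀(m) mod 2}
  y_d = 2^k (y₀ + (−1)^m y₀^β)`". Proof (p0025 L52–L81): "for any `[s] ∈ 2𝒜`, `y₀ − y₀^{σ_s} = 0` or `(1, 0)` and thus
  `(y₀ ± y₀^β)` is fixed by `σ_s` … `Σ y_d = Σ_{[t]∈φ₀} Σ_{[s]∈ψ} (Σ_d χ_d(s)) (z_t)^{σ_s}`. It is clear that the summation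
  in the last bracket is equal to `2^k` for `σ_s = 1`, `(−1)^m·2^k` for `σ_s = β`, and `0` otherwise."
* Proof of Thm. 4.4 (p0026 L2–L51): "`P := (y₀ + (−1)^m y₀^β − Σ y′_d) ∈ E[2^{k+1}] ∩ E(H₀) = E[4] ∩ E(ℚ(√2))`. It follows that
  `P^β − P = 0` or `(0, 0)` and `P^β + P = 0` or `(−1, 0)`. … Note that `(y′_d)^β = (−1)^m y′_d` and therefore `P − (−1)^m P^β =
  y₀ − y₀^{β²}`. Write `β = σ_{t₀}` … `y₀ − y₀^{β²} = Σ_{[t]∈φ₀} z_t − Σ_{[t]∈φ₀} z_{t₀²t} = Σ_{[t]∈φ₁} (z_t − z_{ϖ′t}) =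
  #2𝒜/([t₀]²)·(1, 0) = (1, 0)`. It is a contradiction."
* Notations (ii)–(iii) (p0005 L27–L33): "the class of `t ∈ 2𝒜` if and only if `σ_t` fixes all `√p_j*`"; "`σ_{ϖ_d}` fixes
  `√p*` iff `(d/p) = 1` for `p ∤ d` and `((2n/d)/p) = 1` for `p | d`" — for `n = p₀p₁`, `(p₁/p₀) = −1`: `σ_{[ϖ′_{p₁}]}` fixes
  `√2` (`(2/p₁) = 1`) and moves `√p₁` (`((2p₀)/p₁) = (p₁/p₀) = −1`).

## What is proved here (kernel), and from what

At `k = 1` the four cosets of `2𝒜` are represented by `1, [t₀], B, [t₀]B` (`B = [ϖ′_{p₁}]`), read off from the sign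
patterns on `(√2, √p₁)`: `(+,+), (−,−), (+,−), (−,+)` (§1; the principal-genus sentence `hgen` both ways). With Tian's
`φ₀` (a transversal of `2𝒜/[ϖ′]` inside the squares) the lift `φ = ⋃_c cφ₀` is a transversal of `𝒜/[ϖ′]` and every signed
sum splits as `y_{d,φ} = Σ_c χ_d(c)·σ_c(y₀)` (§2). Evaluating `χ_d` on the four representatives gives (4.9) at `k = 1`:
`y_{p₀,φ} + y_{2n,φ} = 2(y₀ + y₀^β)` and `y_{2p₀,φ} + y_{n,φ} = 2(y₀ − y₀^β)` (§3). The telescoping `y₀^{β²} = y₀ + (1, 0)`,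
the `E[4]` step and the descent itself are in `CMPointSystemDescentOneSeven.lean`.

[cite: Tian2014, Thm. 4.4 (arXiv:1210.8231 p0023 L4–L8), p0025 L19–L29, Lemma 4.8 and its proof (p0025 L30–L81), proof of Thm. 4.4 (p0026 L2–L51), Notations (i)–(iii) (p0005 L22–L33)]
[cite: Monsky1990MockHeegner, Thm. 5.14 (10)/(11) and Cor. 5.15 (3) (p. 66)]
-/

noncomputable section

open scoped Classical

open WeierstrassCurve WeierstrassCurve.Affine NumberField Literature.NumberTheory.EllipticCurves
  Literature.NumberTheory.EllipticCurves.TianYuanZhang2017 Literature.GroupTheory.FiniteAbelian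

set_option autoImplicit false

namespace Literature.NumberTheory.EllipticCurves.Tian2014

namespace CMPointData

variable {n : ℕ}

/-! ## §1 The four cosets of `2𝒜` at `k = 1`: representatives `1, [t₀], B, [t₀]B` from the sign patterns on `(√2, √p₁)` -/

section FourCosets

variable (D : CMPointData n) {θ₂ θ₁ : D.H} {p₁ : ℕ} (hp₁ : p₁ ≠ 0)
  (hθ₂ : θ₂ ^ 2 = ((2 : ℕ) : D.H)) (hθ₁ : θ₁ ^ 2 = (p₁ : D.H))
  (hgen : ∀ s, (D.art s θ₂ = θ₂ ∧ D.art s θ₁ = θ₁) ↔ IsSquare s)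
  {t₀ B : ClassGroup (𝓞 (GenusField (2 * n)))}
  (hβ2 : D.art t₀ θ₂ = -θ₂) (hβ1 : D.art t₀ θ₁ = -θ₁) (hBθ₂ : D.art B θ₂ = θ₂) (hBθ₁ : D.art B θ₁ = -θ₁)

/-- The four representatives `1, [t₀], B, [t₀]B` of `𝒜/2𝒜` at `k = 1` (Tian's `ψ`). [cite: Tian2014, p0025 L22–L25] -/
def reps (t₀ B : ClassGroup (𝓞 (GenusField (2 * n)))) : Fin 4 → ClassGroup (𝓞 (GenusField (2 * n))) :=
  ![1, t₀, B, t₀ * B]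

include hβ2 hBθ₂ in
/-- The action of the four representatives on `√2`. [cite: Tian2014, p0025 L25–L29, Notations (iii) (p0005 L31–L33)] -/
theorem art_reps_theta₂ (i : Fin 4) : D.art (reps t₀ B i) θ₂ = ![θ₂, -θ₂, θ₂, -θ₂] i := by
  fin_cases i
  · simp [reps]
  · simpa [reps] using hβ2
  · simpa [reps] using hBθ₂
  · simp only [reps]
    show D.art (t₀ * B) θ₂ = -θ₂
    rw [map_mul, AlgEquiv.mul_apply, hBθ₂, hβ2]

include hβ1 hBθ₁ in
/-- The action of the four representatives on `√p₁`. [cite: Tian2014, p0025 L25–L29, Notations (iii) (p0005 L31–L33)] -/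
theorem art_reps_theta₁ (i : Fin 4) : D.art (reps t₀ B i) θ₁ = ![θ₁, -θ₁, -θ₁, θ₁] i := by
  fin_cases i
  · simp [reps]
  · simpa [reps] using hβ1
  · simpa [reps] using hBθ₁
  · simp only [reps]
    show D.art (t₀ * B) θ₁ = θ₁
    rw [map_mul, AlgEquiv.mul_apply, hBθ₁, map_neg, hβ1, neg_neg]

omit hp₁ in
include hθ₂ in
/-- `√2 ≠ −√2` (`√2 ∈ H₀ ⊂ H`, a field of characteristic `0`). [cite: Tian2014, §4.2 (p0022 L52–L56)] [folklore] -/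
theorem theta₂_ne_neg : θ₂ ≠ -θ₂ := by
  intro h
  have h0 : θ₂ = 0 := by
    have h2 : (2 : D.H) * θ₂ = 0 := by linear_combination h
    rcases mul_eq_zero.mp h2 with h3 | h3
    · exact absurd h3 two_ne_zero
    · exact h3
  have := hθ₂
  rw [h0, zero_pow two_ne_zero] at this
  have h2 : ((2 : ℕ) : D.H) = 0 := this.symm
  rw [Nat.cast_eq_zero] at h2
  omega

include hp₁ hθ₁ in
/-- `√p₁ ≠ −√p₁` (`√p₁ ∈ H₀ ⊂ H`). [cite: Tian2014, §4.2 (p0022 L52–L53)] [folklore] -/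
theorem theta₁_ne_neg : θ₁ ≠ -θ₁ := by
  intro h
  apply ne_zero_of_sq_eq_natCast' hp₁ hθ₁
  have h2 : (2 : D.H) * θ₁ = 0 := by linear_combination h
  rcases mul_eq_zero.mp h2 with h3 | h3
  · exact absurd h3 two_ne_zero
  · exact h3

include hp₁ hθ₂ hθ₁ hgen hβ2 hβ1 hBθ₂ hBθ₁ in
/-- **The representatives are pairwise incongruent modulo `2𝒜`**: their sign patterns on `(√2, √p₁)` are distinct, and a
square fixes both roots (the trivial half of Notations (ii)). [cite: Tian2014, Notations (ii) (p0005 L27–L30), p0025 L22–L29] -/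
theorem reps_eq_of_isSquare (i j : Fin 4) (h : IsSquare ((reps t₀ B i)⁻¹ * reps t₀ B j)) : i = j := by
  obtain ⟨h₂, h₁⟩ := (hgen _).mpr h
  have e₂ : D.art (reps t₀ B j) θ₂ = D.art (reps t₀ B i) θ₂ := by
    have := congrArg (D.art (reps t₀ B i)) h₂
    rwa [← AlgEquiv.mul_apply, ← map_mul, mul_inv_cancel_left] at this
  have e₁ : D.art (reps t₀ B j) θ₁ = D.art (reps t₀ B i) θ₁ := by
    have := congrArg (D.art (reps t₀ B i)) h₁
    rwa [← AlgEquiv.mul_apply, ← map_mul, mul_inv_cancel_left] at this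
  rw [D.art_reps_theta₂ hβ2 hBθ₂ i, D.art_reps_theta₂ hβ2 hBθ₂ j] at e₂
  rw [D.art_reps_theta₁ hβ1 hBθ₁ i, D.art_reps_theta₁ hβ1 hBθ₁ j] at e₁
  have hne₂ := D.theta₂_ne_neg hθ₂
  have hne₁ := D.theta₁_ne_neg hp₁ hθ₁
  fin_cases i <;> fin_cases j <;>
    simp only [Fin.zero_eta, Fin.mk_one, Fin.reduceFinMk, Matrix.cons_val_zero, Matrix.cons_val_one,
      Matrix.head_cons, Matrix.cons_val_two, Matrix.cons_val_three, Matrix.tail_cons] at e₂ e₁ ⊢ <;>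
    first | rfl | exact absurd e₂ hne₂ | exact absurd e₂.symm hne₂ | exact absurd e₁ hne₁ |
      exact absurd e₁.symm hne₁

include hp₁ hθ₂ hθ₁ hgen hβ2 hβ1 hBθ₂ hBθ₁ in
/-- **Every class lies in the coset of one of the four representatives** ("`ψ` a set of representatives of `𝒜/2𝒜`"): match the
sign pattern of `σ_a` on `(√2, √p₁)` and use the principal-genus sentence (Notations (ii)) for the quotient.
[cite: Tian2014, Notations (ii) (p0005 L27–L30), p0025 L22–L25] -/
theorem exists_reps_isSquare (a : ClassGroup (𝓞 (GenusField (2 * n)))) :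
    ∃ i, IsSquare ((reps t₀ B i)⁻¹ * a) := by
  have hne₂ := D.theta₂_ne_neg hθ₂
  have hne₁ := D.theta₁_ne_neg hp₁ hθ₁
  have hθ₂' : θ₂ ^ 2 = algebraMap ℚ D.H ((2 : ℕ) : ℚ) := sq_eq_algebraMap_of_sq_eq_natCast' hθ₂
  have hθ₁' : θ₁ ^ 2 = algebraMap ℚ D.H (p₁ : ℚ) := sq_eq_algebraMap_of_sq_eq_natCast' hθ₁
  -- the key step: if `σ_{c_i}` and `σ_a` agree on `√2` and `√p₁`, then `c_i⁻¹ a` is a square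
  have key : ∀ i, D.art (reps t₀ B i) θ₂ = D.art a θ₂ → D.art (reps t₀ B i) θ₁ = D.art a θ₁ →
      IsSquare ((reps t₀ B i)⁻¹ * a) := by
    intro i h₂ h₁
    refine (hgen _).mp ⟨?_, ?_⟩
    · rw [map_mul, AlgEquiv.mul_apply, ← h₂, ← AlgEquiv.mul_apply, ← map_mul, inv_mul_cancel, map_one,
        AlgEquiv.one_apply]
    · rw [map_mul, AlgEquiv.mul_apply, ← h₁, ← AlgEquiv.mul_apply, ← map_mul, inv_mul_cancel, map_one,
        AlgEquiv.one_apply]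
  rcases gal_sqrt_pos_eq_or_eq_neg 2 θ₂ hθ₂' (D.art a) with ha₂ | ha₂ <;>
    rcases gal_sqrt_pos_eq_or_eq_neg p₁ θ₁ hθ₁' (D.art a) with ha₁ | ha₁
  · exact ⟨0, key 0 (by rw [D.art_reps_theta₂ hβ2 hBθ₂, ha₂]; rfl)
      (by rw [D.art_reps_theta₁ hβ1 hBθ₁, ha₁]; rfl)⟩
  · exact ⟨2, key 2 (by rw [D.art_reps_theta₂ hβ2 hBθ₂, ha₂]; rfl)
      (by rw [D.art_reps_theta₁ hβ1 hBθ₁, ha₁]; rfl)⟩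
  · exact ⟨3, key 3 (by rw [D.art_reps_theta₂ hβ2 hBθ₂, ha₂]; rfl)
      (by rw [D.art_reps_theta₁ hβ1 hBθ₁, ha₁]; rfl)⟩
  · exact ⟨1, key 1 (by rw [D.art_reps_theta₂ hβ2 hBθ₂, ha₂]; rfl)
      (by rw [D.art_reps_theta₁ hβ1 hBθ₁, ha₁]; rfl)⟩

end FourCosets

/-! ## §2 The signed sums over the lifted transversal `φ = ⋃_i c_i φ₀`: `y_{d,φ} = Σ_i χ_d(c_i)·σ_{c_i}(y₀)` -/

section LiftedSums

variable (D : CMPointData n) (c : Fin 4 → ClassGroup (𝓞 (GenusField (2 * n))))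
  (hCu : ∀ i j, IsSquare ((c i)⁻¹ * c j) → i = j)
  {φ₀ : Finset (ClassGroup (𝓞 (GenusField (2 * n))))} (hφ₀S : ∀ g ∈ φ₀, IsSquare g)

include hCu hφ₀S

/-- **`y_{2n,φ} = Σ_i σ_{c_i}(y₀)`** for `φ = ⋃_i c_i φ₀`, `y₀ = Σ_{φ₀} z_t` ((4.8): `z_{c g} = σ_c(z_g)`).
[cite: Tian2014, Lemma 4.8 proof (p0025 L59–L81), (4.8) (p0023 L46–L50)] -/
theorem yPoint_image_eq (h48 : D.eq48) :
    D.yPoint (((Finset.univ : Finset (Fin 4)) ×ˢ φ₀).image (fun p => c p.1 * p.2)) =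
      ∑ i, D.act (D.art (c i)) (D.yPoint φ₀) := by
  unfold yPoint
  rw [sum_image_mul_eq c hCu hφ₀S D.z]
  refine Finset.sum_congr rfl (fun i _ => ?_)
  rw [map_sum]
  exact Finset.sum_congr rfl (fun g _ => (h48 (c i) g).symm)

/-- **`y_{d,φ} = Σ_i χ_d(c_i)·σ_{c_i}(y₀)`** for `φ = ⋃_i c_i φ₀` (`χ_d` trivial on the squares `φ₀`).
[cite: Tian2014, Lemma 4.8 proof (p0025 L59–L81), (4.8) (p0023 L46–L50)] -/
theorem yPointChi_image_eq (h48 : D.eq48) {θ' : D.H} {c' : ℚ} (hθ' : θ' ^ 2 = algebraMap ℚ D.H c') :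
    D.yPointChi θ' (((Finset.univ : Finset (Fin 4)) ×ˢ φ₀).image (fun p => c p.1 * p.2)) =
      ∑ i, D.chi θ' (c i) • D.act (D.art (c i)) (D.yPoint φ₀) := by
  unfold yPointChi yPoint
  rw [sum_image_mul_eq c hCu hφ₀S (fun a => D.chi θ' a • D.z a)]
  refine Finset.sum_congr rfl (fun i _ => ?_)
  rw [map_sum, Finset.smul_sum]
  refine Finset.sum_congr rfl (fun g hg => ?_)
  rw [D.chi_mul hθ', D.chi_of_isSquare hθ' (hφ₀S g hg), mul_one, h48 (c i) g]

end LiftedSums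

/-! ## §3 The relation (4.9) at `k = 1`, both twists, on the lifted transversal -/

section RelationFourNine

variable (D : CMPointData n) {θ₂ θ₁ : D.H} {p₁ : ℕ} (hp₁ : p₁ ≠ 0) (hn0 : n ≠ 0)
  (hθ₂ : θ₂ ^ 2 = ((2 : ℕ) : D.H)) (hθ₁ : θ₁ ^ 2 = (p₁ : D.H))
  (hgen : ∀ s, (D.art s θ₂ = θ₂ ∧ D.art s θ₁ = θ₁) ↔ IsSquare s)
  {t₀ B : ClassGroup (𝓞 (GenusField (2 * n)))}
  (hβ2 : D.art t₀ θ₂ = -θ₂) (hβ1 : D.art t₀ θ₁ = -θ₁) (hBθ₂ : D.art B θ₂ = θ₂) (hBθ₁ : D.art B θ₁ = -θ₁)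
  {φ₀ : Finset (ClassGroup (𝓞 (GenusField (2 * n))))} (hφ₀S : ∀ g ∈ φ₀, IsSquare g)

omit hp₁ hθ₁ hgen hβ1 hBθ₁ hφ₀S in
include hn0 in
/-- `χ` attached to `√−2n/θ` at a class fixing `θ` is `1`, at a class negating `θ` is `−1` (`σ_s` fixes `√−2n`).
[cite: Tian2014, §4.2 (p0022 L77–L83)] -/
theorem chi_div_eq {θ : D.H} (hθ0 : θ ≠ 0) (hart : ∀ s, D.art s D.sqrtNegTwoN = D.sqrtNegTwoN)
    (s : ClassGroup (𝓞 (GenusField (2 * n)))) :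
    (D.art s θ = θ → D.chi (D.sqrtNegTwoN / θ) s = 1) ∧ (D.art s θ = -θ → D.chi (D.sqrtNegTwoN / θ) s = -1) := by
  have hne : -(D.sqrtNegTwoN / θ) ≠ D.sqrtNegTwoN / θ := by
    intro h
    have h0 : D.sqrtNegTwoN / θ = 0 := by
      have h2 : (2 : D.H) * (D.sqrtNegTwoN / θ) = 0 := by linear_combination -h
      rcases mul_eq_zero.mp h2 with h3 | h3
      · exact absurd h3 two_ne_zero
      · exact h3
    exact div_ne_zero (D.sqrtNegTwoN_ne_zero hn0) hθ0 h0
  constructor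
  · intro h
    unfold chi
    rw [map_div₀, hart s, h, if_pos rfl]
  · intro h
    unfold chi
    rw [map_div₀, hart s, h, div_neg, if_neg hne]

include hp₁ hn0 hθ₂ hθ₁ hgen hβ2 hβ1 hBθ₂ hBθ₁ hφ₀S in
/-- **(4.9) at `k = 1`, the even twist `m = 2n`: `y_{p₀,φ} + y_{2n,φ} = 2(y₀ + y₀^β)`** on `φ = ⋃_i c_i φ₀`, with
`√−p₀ = √−2n/(√2·√p₁)`: `χ_{p₀}` is `+1` on `1, [t₀]` and `−1` on `B, [t₀]B`.
[cite: Tian2014, Lemma 4.8 (4.9) and its proof (p0025 L41–L51, L59–L81)] -/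
theorem yPointChi_add_yPoint_eq_two_nsmul_add (hP : D.Printed) :
    D.yPointChi (D.sqrtNegTwoN / (θ₂ * θ₁)) (((Finset.univ : Finset (Fin 4)) ×ˢ φ₀).image
        (fun p => reps t₀ B p.1 * p.2)) +
      D.yPoint (((Finset.univ : Finset (Fin 4)) ×ˢ φ₀).image (fun p => reps t₀ B p.1 * p.2)) =
      (2 : ℕ) • (D.yPoint φ₀ + D.act (D.art t₀) (D.yPoint φ₀)) := by
  have hP' := hP
  obtain ⟨-, -, -, h48, hart, -, -, -, -, -, -⟩ := hP'
  have hart' : ∀ s, D.art s D.sqrtNegTwoN = D.sqrtNegTwoN := fun s => (hart s).2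
  have hCu := D.reps_eq_of_isSquare hp₁ hθ₂ hθ₁ hgen hβ2 hβ1 hBθ₂ hBθ₁
  have hθ₂0 : θ₂ ≠ 0 := ne_zero_of_sq_eq_natCast' two_ne_zero hθ₂
  have hθ₁0 : θ₁ ≠ 0 := ne_zero_of_sq_eq_natCast' hp₁ hθ₁
  have hθ' : (D.sqrtNegTwoN / (θ₂ * θ₁)) ^ 2 = algebraMap ℚ D.H (-((2 * n : ℕ) : ℚ) / ((2 * p₁ : ℕ) : ℚ)) := by
    rw [div_pow, mul_pow, hθ₂, hθ₁, D.sqrtNegTwoN_sq, map_div₀, map_neg, map_natCast, map_natCast]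
    push_cast
    ring
  rw [D.yPointChi_image_eq (reps t₀ B) hCu hφ₀S h48 hθ', D.yPoint_image_eq (reps t₀ B) hCu hφ₀S h48,
    Fin.sum_univ_four, Fin.sum_univ_four]
  -- the values of `χ_{p₀}` on the four representatives
  have hc := D.chi_div_eq hn0 (mul_ne_zero hθ₂0 hθ₁0) hart'
  have hchi : ∀ i, D.chi (D.sqrtNegTwoN / (θ₂ * θ₁)) (reps t₀ B i) =
      ![(1 : ℤ), 1, -1, -1] i := by
    intro i
    fin_cases i
    · show D.chi (D.sqrtNegTwoN / (θ₂ * θ₁)) (reps t₀ B 0) = 1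
      exact (hc _).1 (by rw [map_mul, D.art_reps_theta₂ hβ2 hBθ₂ 0, D.art_reps_theta₁ hβ1 hBθ₁ 0]; rfl)
    · show D.chi (D.sqrtNegTwoN / (θ₂ * θ₁)) (reps t₀ B 1) = 1
      exact (hc _).1 (by
        rw [map_mul, D.art_reps_theta₂ hβ2 hBθ₂ 1, D.art_reps_theta₁ hβ1 hBθ₁ 1]
        show -θ₂ * -θ₁ = θ₂ * θ₁
        ring)
    · show D.chi (D.sqrtNegTwoN / (θ₂ * θ₁)) (reps t₀ B 2) = -1
      exact (hc _).2 (by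
        rw [map_mul, D.art_reps_theta₂ hβ2 hBθ₂ 2, D.art_reps_theta₁ hβ1 hBθ₁ 2]
        show θ₂ * -θ₁ = -(θ₂ * θ₁)
        ring)
    · show D.chi (D.sqrtNegTwoN / (θ₂ * θ₁)) (reps t₀ B 3) = -1
      exact (hc _).2 (by
        rw [map_mul, D.art_reps_theta₂ hβ2 hBθ₂ 3, D.art_reps_theta₁ hβ1 hBθ₁ 3]
        show -θ₂ * θ₁ = -(θ₂ * θ₁)
        ring)
  simp only [hchi]
  simp only [reps, Matrix.cons_val_zero, Matrix.cons_val_one, Matrix.head_cons, Matrix.cons_val_two,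
    Matrix.cons_val_three, Matrix.tail_cons, one_zsmul, neg_one_zsmul, map_one, act_one, two_nsmul]
  abel

include hp₁ hn0 hθ₂ hθ₁ hgen hβ2 hβ1 hBθ₂ hBθ₁ hφ₀S in
/-- **(4.9) at `k = 1`, the odd twist `m = n`: `y_{2p₀,φ} + y_{n,φ} = 2(y₀ − y₀^β)`** on `φ = ⋃_i c_i φ₀`, with
`√−2p₀ = √−2n/√p₁` and `√−n = √−2n/√2`: `χ_{2p₀} + χ_n` is `2` on `1`, `−2` on `[t₀]`, `0` on `B`, `[t₀]B`.
[cite: Tian2014, Lemma 4.8 (4.9) and its proof (p0025 L41–L51, L59–L81)] -/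
theorem yPointChi_add_yPointChi_eq_two_nsmul_sub (hP : D.Printed) :
    D.yPointChi (D.sqrtNegTwoN / θ₁) (((Finset.univ : Finset (Fin 4)) ×ˢ φ₀).image
        (fun p => reps t₀ B p.1 * p.2)) +
      D.yPointChi (D.sqrtNegTwoN / θ₂) (((Finset.univ : Finset (Fin 4)) ×ˢ φ₀).image
        (fun p => reps t₀ B p.1 * p.2)) =
      (2 : ℕ) • (D.yPoint φ₀ - D.act (D.art t₀) (D.yPoint φ₀)) := by
  have hP' := hP
  obtain ⟨-, -, -, h48, hart, -, -, -, -, -, -⟩ := hP'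
  have hart' : ∀ s, D.art s D.sqrtNegTwoN = D.sqrtNegTwoN := fun s => (hart s).2
  have hCu := D.reps_eq_of_isSquare hp₁ hθ₂ hθ₁ hgen hβ2 hβ1 hBθ₂ hBθ₁
  have hθ₂0 : θ₂ ≠ 0 := ne_zero_of_sq_eq_natCast' two_ne_zero hθ₂
  have hθ₁0 : θ₁ ≠ 0 := ne_zero_of_sq_eq_natCast' hp₁ hθ₁
  have hθ₁' : (D.sqrtNegTwoN / θ₁) ^ 2 = algebraMap ℚ D.H (-((2 * n : ℕ) : ℚ) / (p₁ : ℚ)) := by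
    rw [div_pow, hθ₁, D.sqrtNegTwoN_sq, map_div₀, map_neg, map_natCast, map_natCast]
  have hθ₂' : (D.sqrtNegTwoN / θ₂) ^ 2 = algebraMap ℚ D.H (-((2 * n : ℕ) : ℚ) / ((2 : ℕ) : ℚ)) := by
    rw [div_pow, hθ₂, D.sqrtNegTwoN_sq, map_div₀, map_neg, map_natCast, map_natCast]
  rw [D.yPointChi_image_eq (reps t₀ B) hCu hφ₀S h48 hθ₁', D.yPointChi_image_eq (reps t₀ B) hCu hφ₀S h48 hθ₂',
    Fin.sum_univ_four, Fin.sum_univ_four]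
  have hc₁ := D.chi_div_eq hn0 hθ₁0 hart'
  have hc₂ := D.chi_div_eq hn0 hθ₂0 hart'
  have hchi₁ : ∀ i, D.chi (D.sqrtNegTwoN / θ₁) (reps t₀ B i) = ![(1 : ℤ), -1, -1, 1] i := by
    intro i
    fin_cases i
    · show D.chi (D.sqrtNegTwoN / θ₁) (reps t₀ B 0) = 1
      exact (hc₁ _).1 (D.art_reps_theta₁ hβ1 hBθ₁ 0)
    · show D.chi (D.sqrtNegTwoN / θ₁) (reps t₀ B 1) = -1
      exact (hc₁ _).2 (D.art_reps_theta₁ hβ1 hBθ₁ 1)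
    · show D.chi (D.sqrtNegTwoN / θ₁) (reps t₀ B 2) = -1
      exact (hc₁ _).2 (D.art_reps_theta₁ hβ1 hBθ₁ 2)
    · show D.chi (D.sqrtNegTwoN / θ₁) (reps t₀ B 3) = 1
      exact (hc₁ _).1 (D.art_reps_theta₁ hβ1 hBθ₁ 3)
  have hchi₂ : ∀ i, D.chi (D.sqrtNegTwoN / θ₂) (reps t₀ B i) = ![(1 : ℤ), -1, 1, -1] i := by
    intro i
    fin_cases i
    · show D.chi (D.sqrtNegTwoN / θ₂) (reps t₀ B 0) = 1
      exact (hc₂ _).1 (D.art_reps_theta₂ hβ2 hBθ₂ 0)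
    · show D.chi (D.sqrtNegTwoN / θ₂) (reps t₀ B 1) = -1
      exact (hc₂ _).2 (D.art_reps_theta₂ hβ2 hBθ₂ 1)
    · show D.chi (D.sqrtNegTwoN / θ₂) (reps t₀ B 2) = 1
      exact (hc₂ _).1 (D.art_reps_theta₂ hβ2 hBθ₂ 2)
    · show D.chi (D.sqrtNegTwoN / θ₂) (reps t₀ B 3) = -1
      exact (hc₂ _).2 (D.art_reps_theta₂ hβ2 hBθ₂ 3)
  simp only [hchi₁, hchi₂]
  simp only [reps, Matrix.cons_val_zero, Matrix.cons_val_one, Matrix.head_cons, Matrix.cons_val_two,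
    Matrix.cons_val_three, Matrix.tail_cons, one_zsmul, neg_one_zsmul, map_one, act_one, two_nsmul]
  abel

end RelationFourNine

end CMPointData

end Literature.NumberTheory.EllipticCurves.Tian2014

end
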